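import Summits.CriticalPhenomena.PercolationContinuityZ3.Theorems.PercNearOneGluingNoHeavyLowerTailForestRayleighStepsMixed
import Summits.CriticalPhenomena.PercolationContinuityZ3.Theorems.PercNearOneGluingNoHeavyLowerTailForestRayleighStepsThree
import Summits.CriticalPhenomena.PercolationContinuityZ3.Theorems.PercNearOneGluingNoHeavyLowerTailForestRayleighDispatch
import HarnessLib

/-!
# Weighted forest negative correlation on graphs of tree-width ≤ 2 — VII: dispatch at a series vertex avoiding `e, f`

Notation as in `…ForestRayleighTools`; `ih` = the packaged induction hypothesis of
`…ForestRayleighDispatch` (the Rayleigh inequality `(R)` for every admissible instance inside `T`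
with fewer edges, all nonnegative activities).

The vertex `v` meets exactly two edges `vu₁, vu₂` of `E = D ∪ K ∪ {e,f} ⊆ T`, both in `D ∪ K`, and
the chord `u₁u₂` lies in `T`. `step_series_pin_free_ih` (one pinned, one free),
`step_series_free_free_ih` (both free), `step_series_pin_pin_ih` (both pinned) feed `ih` into the
step lemmas of `…StepsMixed` / `…StepsThree` / `…StepsTwo` under the proviso `u₁u₂ ≠ f`;
`step_series_two` removes the proviso by the `e ↔ f` symmetry and dispatches on the positions.
Theorems only; no definitions, no `sorry`.
-/

open Finset SimpleGraph
open scoped Classical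

namespace Summit.CriticalPhenomena.PercolationContinuityZ3.Theorems.ForestRayleigh

variable {V : Type*} [Fintype V] [DecidableEq V]

/-! ### §1 One edge pinned, one free -/

/-- **Induction step, series vertex with `vu₁` pinned and `vu₂` free** (chord `≠ f`).
[S–W Prop. 3.7 via `lsm_series_pin_free`] -/
theorem step_series_pin_free_ih (T : Finset (Sym2 V)) (hT : ∀ x ∈ T, ¬x.IsDiag) (w : Sym2 V → ℝ)
    (hw : ∀ x, 0 ≤ w x) (D K : Finset (Sym2 V)) (e f : Sym2 V) {v u₁ u₂ : V}
    (hsub : D ∪ insert e (insert f K) ⊆ T) (hDK : Disjoint D K) (heD : e ∉ D) (heK : e ∉ K)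
    (hfD : f ∉ D) (hfK : f ∉ K) (hef : e ≠ f) (hu : u₁ ≠ u₂)
    (honly : ∀ z ∈ D ∪ insert e (insert f K), v ∈ z → z = s(v, u₁) ∨ z = s(v, u₂))
    (hhT : s(u₁, u₂) ∈ T) (hhf : s(u₁, u₂) ≠ f)
    (hg₁ : s(v, u₁) ∈ K) (hg₂ : s(v, u₂) ∈ D)
    (ih : ∀ (w' : Sym2 V → ℝ), (∀ x, 0 ≤ w' x) → ∀ (D' K' : Finset (Sym2 V)) (e' f' : Sym2 V),
      (D' ∪ insert e' (insert f' K')).card < (D ∪ insert e (insert f K)).card →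
      D' ∪ insert e' (insert f' K') ⊆ T → Disjoint D' K' → e' ∉ D' → e' ∉ K' → f' ∉ D' →
      f' ∉ K' → e' ≠ f' →
      (∑ G ∈ D'.powerset.filter (fun G =>
        (fromEdgeSet ((G ∪ (insert e' (insert f' K')) : Finset (Sym2 V)) : Set (Sym2 V))).IsAcyclic), ∏ x ∈ G, w' x) *
      (∑ G ∈ D'.powerset.filter (fun G =>
        (fromEdgeSet ((G ∪ K' : Finset (Sym2 V)) : Set (Sym2 V))).IsAcyclic), ∏ x ∈ G, w' x) ≤
    (∑ G ∈ D'.powerset.filter (fun G =>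
        (fromEdgeSet ((G ∪ (insert e' K') : Finset (Sym2 V)) : Set (Sym2 V))).IsAcyclic), ∏ x ∈ G, w' x) *
      (∑ G ∈ D'.powerset.filter (fun G =>
        (fromEdgeSet ((G ∪ (insert f' K') : Finset (Sym2 V)) : Set (Sym2 V))).IsAcyclic), ∏ x ∈ G, w' x)) :
    (∑ G ∈ D.powerset.filter (fun G =>
        (fromEdgeSet ((G ∪ (insert e (insert f K)) : Finset (Sym2 V)) : Set (Sym2 V))).IsAcyclic), ∏ x ∈ G, w x) *
      (∑ G ∈ D.powerset.filter (fun G =>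
        (fromEdgeSet ((G ∪ K : Finset (Sym2 V)) : Set (Sym2 V))).IsAcyclic), ∏ x ∈ G, w x) ≤
    (∑ G ∈ D.powerset.filter (fun G =>
        (fromEdgeSet ((G ∪ (insert e K) : Finset (Sym2 V)) : Set (Sym2 V))).IsAcyclic), ∏ x ∈ G, w x) *
      (∑ G ∈ D.powerset.filter (fun G =>
        (fromEdgeSet ((G ∪ (insert f K) : Finset (Sym2 V)) : Set (Sym2 V))).IsAcyclic), ∏ x ∈ G, w x) := by
  have hg₁E : s(v, u₁) ∈ D ∪ insert e (insert f K) := by simp [hg₁]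
  have hg₂E : s(v, u₂) ∈ D ∪ insert e (insert f K) := by simp [hg₂]
  have hE : ∀ x ∈ D ∪ insert e (insert f K), ¬x.IsDiag := fun x hx => hT x (hsub hx)
  have hvu₁ : v ≠ u₁ := fun hh => hE _ hg₁E (Sym2.mk_isDiag_iff.2 hh)
  have hvu₂ : v ≠ u₂ := fun hh => hE _ hg₂E (Sym2.mk_isDiag_iff.2 hh)
  have hg₁₂ : s(v, u₁) ≠ s(v, u₂) := fun hh => hu (Sym2.congr_right.1 hh)
  have hv : ∀ z ∈ D ∪ insert e (insert f K), z ≠ s(v, u₁) → z ≠ s(v, u₂) → v ∉ z :=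
    fun z hz h₁ h₂ hvz => (honly z hz hvz).elim h₁ h₂
  have heE : e ∈ D ∪ insert e (insert f K) := by simp
  have hfE : f ∈ D ∪ insert e (insert f K) := by simp
  have hg₁D : s(v, u₁) ∉ D := Finset.disjoint_right.1 hDK hg₁
  have hg₂K : s(v, u₂) ∉ K := Finset.disjoint_left.1 hDK hg₂
  have hg₁e : s(v, u₁) ≠ e := fun hh => heK (hh ▸ hg₁)
  have hg₁f : s(v, u₁) ≠ f := fun hh => hfK (hh ▸ hg₁)
  have hg₂e : s(v, u₂) ≠ e := fun hh => heD (hh ▸ hg₂)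
  have hg₂f : s(v, u₂) ≠ f := fun hh => hfD (hh ▸ hg₂)
  have hD' : D = insert s(v, u₂) (D.erase s(v, u₂)) := (Finset.insert_erase hg₂).symm
  have hK' : K = insert s(v, u₁) (K.erase s(v, u₁)) := (Finset.insert_erase hg₁).symm
  have sD : D.erase s(v, u₂) ⊆ D := Finset.erase_subset _ _
  have sK : K.erase s(v, u₁) ⊆ K := Finset.erase_subset _ _
  have dis₀ : Disjoint (D.erase s(v, u₂)) (K.erase s(v, u₁)) :=
    Finset.disjoint_of_subset_left sD (Finset.disjoint_of_subset_right sK hDK)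
  have sub₀ : D.erase s(v, u₂) ∪ insert e (insert f (K.erase s(v, u₁))) ⊆ D ∪ insert e (insert f K) :=
    Finset.union_subset_union sD (Finset.insert_subset_insert e (Finset.insert_subset_insert f sK))
  rw [hD', hK']
  refine lsm_series_pin_free w hw (D.erase s(v, u₂)) (K.erase s(v, u₁)) e f (fun x hx => hE x ?_)
    (fun x hx => hv x (sub₀ hx) ?_ ?_) hu hhf (fun hh => heD (sD hh)) (fun hh => heK (sK hh)) ?_ ?_
  · simp only [Finset.mem_union, Finset.mem_insert] at hx ⊢
    rcases hx with hx | hx | hx | hx | hx | hx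
    · exact Or.inl (sD hx)
    · exact Or.inr (Or.inl hx)
    · exact Or.inr (Or.inr (Or.inl hx))
    · exact Or.inl (hx ▸ hg₂)
    · exact Or.inr (Or.inr (Or.inr (hx ▸ hg₁)))
    · exact Or.inr (Or.inr (Or.inr (sK hx)))
  · rcases Finset.mem_union.1 hx with hx | hx
    · exact fun hh => hg₁D (hh ▸ sD hx)
    · rcases Finset.mem_insert.1 hx with rfl | hx
      · exact hg₁e.symm
      rcases Finset.mem_insert.1 hx with rfl | hx
      · exact hg₁f.symm
      · exact (Finset.mem_erase.1 hx).1
  · rcases Finset.mem_union.1 hx with hx | hx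
    · exact (Finset.mem_erase.1 hx).1
    · rcases Finset.mem_insert.1 hx with rfl | hx
      · exact hg₂e.symm
      rcases Finset.mem_insert.1 hx with rfl | hx
      · exact hg₂f.symm
      · exact fun hh => hg₂K (hh ▸ sK hx)
  · -- the re-weighted instance `D₀ ∪ h`
    intro c hc hhK hhe
    refine ih (Function.update w s(u₁, u₂) c) (update_nonneg w hw _ hc)
      (insert s(u₁, u₂) ((D.erase s(v, u₂)).erase s(u₁, u₂))) (K.erase s(v, u₁)) e f ?_ ?_ ?_ ?_
      (fun hh => heK (sK hh)) ?_ (fun hh => hfK (sK hh)) hef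
    · refine card_lt_of_subset_series (h := s(u₁, u₂)) hg₁E hg₂E hg₁₂ fun x hx => ?_
      rcases Finset.mem_union.1 hx with hx | hx
      · rcases Finset.mem_insert.1 hx with hx | hx
        · exact Or.inl hx
        · have hxD := sD (Finset.mem_of_mem_erase hx)
          exact Or.inr ⟨Finset.mem_union_left _ hxD, fun hh => hg₁D (hh ▸ hxD),
            (Finset.mem_erase.1 (Finset.mem_of_mem_erase hx)).1⟩
      · rcases Finset.mem_insert.1 hx with rfl | hx
        · exact Or.inr ⟨heE, hg₁e.symm, hg₂e.symm⟩
        rcases Finset.mem_insert.1 hx with rfl | hx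
        · exact Or.inr ⟨hfE, hg₁f.symm, hg₂f.symm⟩
        · exact Or.inr ⟨by simp [sK hx], (Finset.mem_erase.1 hx).1, fun hh => hg₂K (hh ▸ sK hx)⟩
    · intro x hx
      rcases Finset.mem_union.1 hx with hx | hx
      · rcases Finset.mem_insert.1 hx with rfl | hx
        · exact hhT
        · exact hsub (Finset.mem_union_left _ (sD (Finset.mem_of_mem_erase hx)))
      · exact hsub (sub₀ (Finset.mem_union_right _ hx))
    · exact Finset.disjoint_insert_left.2
        ⟨hhK, Finset.disjoint_of_subset_left (Finset.erase_subset _ _) dis₀⟩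
    · rw [Finset.mem_insert, not_or]
      exact ⟨fun hh => hhe hh.symm, fun hh => heD (sD (Finset.mem_of_mem_erase hh))⟩
    · rw [Finset.mem_insert, not_or]
      exact ⟨fun hh => hhf hh.symm, fun hh => hfD (sD (Finset.mem_of_mem_erase hh))⟩
  · -- the plain instance `D₀`
    intro _
    refine ih w hw (D.erase s(v, u₂)) (K.erase s(v, u₁)) e f ?_ (sub₀.trans hsub) dis₀
      (fun hh => heD (sD hh)) (fun hh => heK (sK hh)) (fun hh => hfD (sD hh))
      (fun hh => hfK (sK hh)) hef
    refine card_lt_of_subset_series (h := s(u₁, u₂)) hg₁E hg₂E hg₁₂ fun x hx => Or.inr ⟨sub₀ hx, ?_, ?_⟩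
    · rcases Finset.mem_union.1 hx with hx | hx
      · exact fun hh => hg₁D (hh ▸ sD hx)
      · rcases Finset.mem_insert.1 hx with rfl | hx
        · exact hg₁e.symm
        rcases Finset.mem_insert.1 hx with rfl | hx
        · exact hg₁f.symm
        · exact (Finset.mem_erase.1 hx).1
    · rcases Finset.mem_union.1 hx with hx | hx
      · exact (Finset.mem_erase.1 hx).1
      · rcases Finset.mem_insert.1 hx with rfl | hx
        · exact hg₂e.symm
        rcases Finset.mem_insert.1 hx with rfl | hx
        · exact hg₂f.symm
        · exact fun hh => hg₂K (hh ▸ sK hx)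

/-! ### §2 Both edges free -/

/-- **Induction step, series vertex with both edges free** (chord `≠ f`).
[S–W Prop. 3.7 via `lsm_series_free_free`] -/
theorem step_series_free_free_ih (T : Finset (Sym2 V)) (hT : ∀ x ∈ T, ¬x.IsDiag) (w : Sym2 V → ℝ)
    (hw : ∀ x, 0 ≤ w x) (D K : Finset (Sym2 V)) (e f : Sym2 V) {v u₁ u₂ : V}
    (hsub : D ∪ insert e (insert f K) ⊆ T) (hDK : Disjoint D K) (heD : e ∉ D) (heK : e ∉ K)
    (hfD : f ∉ D) (hfK : f ∉ K) (hef : e ≠ f) (hu : u₁ ≠ u₂)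
    (honly : ∀ z ∈ D ∪ insert e (insert f K), v ∈ z → z = s(v, u₁) ∨ z = s(v, u₂))
    (hhT : s(u₁, u₂) ∈ T) (hhf : s(u₁, u₂) ≠ f)
    (hg₁ : s(v, u₁) ∈ D) (hg₂ : s(v, u₂) ∈ D)
    (ih : ∀ (w' : Sym2 V → ℝ), (∀ x, 0 ≤ w' x) → ∀ (D' K' : Finset (Sym2 V)) (e' f' : Sym2 V),
      (D' ∪ insert e' (insert f' K')).card < (D ∪ insert e (insert f K)).card →
      D' ∪ insert e' (insert f' K') ⊆ T → Disjoint D' K' → e' ∉ D' → e' ∉ K' → f' ∉ D' →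
      f' ∉ K' → e' ≠ f' →
      (∑ G ∈ D'.powerset.filter (fun G =>
        (fromEdgeSet ((G ∪ (insert e' (insert f' K')) : Finset (Sym2 V)) : Set (Sym2 V))).IsAcyclic), ∏ x ∈ G, w' x) *
      (∑ G ∈ D'.powerset.filter (fun G =>
        (fromEdgeSet ((G ∪ K' : Finset (Sym2 V)) : Set (Sym2 V))).IsAcyclic), ∏ x ∈ G, w' x) ≤
    (∑ G ∈ D'.powerset.filter (fun G =>
        (fromEdgeSet ((G ∪ (insert e' K') : Finset (Sym2 V)) : Set (Sym2 V))).IsAcyclic), ∏ x ∈ G, w' x) *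
      (∑ G ∈ D'.powerset.filter (fun G =>
        (fromEdgeSet ((G ∪ (insert f' K') : Finset (Sym2 V)) : Set (Sym2 V))).IsAcyclic), ∏ x ∈ G, w' x)) :
    (∑ G ∈ D.powerset.filter (fun G =>
        (fromEdgeSet ((G ∪ (insert e (insert f K)) : Finset (Sym2 V)) : Set (Sym2 V))).IsAcyclic), ∏ x ∈ G, w x) *
      (∑ G ∈ D.powerset.filter (fun G =>
        (fromEdgeSet ((G ∪ K : Finset (Sym2 V)) : Set (Sym2 V))).IsAcyclic), ∏ x ∈ G, w x) ≤
    (∑ G ∈ D.powerset.filter (fun G =>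
        (fromEdgeSet ((G ∪ (insert e K) : Finset (Sym2 V)) : Set (Sym2 V))).IsAcyclic), ∏ x ∈ G, w x) *
      (∑ G ∈ D.powerset.filter (fun G =>
        (fromEdgeSet ((G ∪ (insert f K) : Finset (Sym2 V)) : Set (Sym2 V))).IsAcyclic), ∏ x ∈ G, w x) := by
  have hg₁E : s(v, u₁) ∈ D ∪ insert e (insert f K) := by simp [hg₁]
  have hg₂E : s(v, u₂) ∈ D ∪ insert e (insert f K) := by simp [hg₂]
  have hE : ∀ x ∈ D ∪ insert e (insert f K), ¬x.IsDiag := fun x hx => hT x (hsub hx)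
  have hvu₁ : v ≠ u₁ := fun hh => hE _ hg₁E (Sym2.mk_isDiag_iff.2 hh)
  have hvu₂ : v ≠ u₂ := fun hh => hE _ hg₂E (Sym2.mk_isDiag_iff.2 hh)
  have hg₁₂ : s(v, u₁) ≠ s(v, u₂) := fun hh => hu (Sym2.congr_right.1 hh)
  have hv : ∀ z ∈ D ∪ insert e (insert f K), z ≠ s(v, u₁) → z ≠ s(v, u₂) → v ∉ z :=
    fun z hz h₁ h₂ hvz => (honly z hz hvz).elim h₁ h₂
  have heE : e ∈ D ∪ insert e (insert f K) := by simp
  have hfE : f ∈ D ∪ insert e (insert f K) := by simp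
  have hg₁K : s(v, u₁) ∉ K := Finset.disjoint_left.1 hDK hg₁
  have hg₂K : s(v, u₂) ∉ K := Finset.disjoint_left.1 hDK hg₂
  have hg₁e : s(v, u₁) ≠ e := fun hh => heD (hh ▸ hg₁)
  have hg₁f : s(v, u₁) ≠ f := fun hh => hfD (hh ▸ hg₁)
  have hg₂e : s(v, u₂) ≠ e := fun hh => heD (hh ▸ hg₂)
  have hg₂f : s(v, u₂) ≠ f := fun hh => hfD (hh ▸ hg₂)
  have hg₂' : s(v, u₂) ∈ D.erase s(v, u₁) := Finset.mem_erase.2 ⟨hg₁₂.symm, hg₂⟩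
  have hD' : D = insert s(v, u₁) (insert s(v, u₂) ((D.erase s(v, u₁)).erase s(v, u₂))) := by
    rw [Finset.insert_erase hg₂', Finset.insert_erase hg₁]
  have sD : (D.erase s(v, u₁)).erase s(v, u₂) ⊆ D :=
    (Finset.erase_subset _ _).trans (Finset.erase_subset _ _)
  have dis₀ : Disjoint ((D.erase s(v, u₁)).erase s(v, u₂)) K := Finset.disjoint_of_subset_left sD hDK
  have sub₀ : (D.erase s(v, u₁)).erase s(v, u₂) ∪ insert e (insert f K) ⊆ D ∪ insert e (insert f K) :=
    Finset.union_subset_union sD subset_rfl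
  have hx₁₂ : ∀ x ∈ (D.erase s(v, u₁)).erase s(v, u₂), x ≠ s(v, u₁) ∧ x ≠ s(v, u₂) := fun x hx =>
    ⟨(Finset.mem_erase.1 (Finset.mem_of_mem_erase hx)).1, (Finset.mem_erase.1 hx).1⟩
  rw [hD']
  refine lsm_series_free_free w hw ((D.erase s(v, u₁)).erase s(v, u₂)) K e f (fun x hx => hE x ?_)
    (fun x hx => hv x (sub₀ hx) ?_ ?_) hu hhf (fun hh => heD (sD hh)) heK ?_ ?_
  · simp only [Finset.mem_union, Finset.mem_insert] at hx ⊢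
    rcases hx with hx | hx | hx | hx | hx | hx
    · exact Or.inl (sD hx)
    · exact Or.inr (Or.inl hx)
    · exact Or.inr (Or.inr (Or.inl hx))
    · exact Or.inl (hx ▸ hg₂)
    · exact Or.inl (hx ▸ hg₁)
    · exact Or.inr (Or.inr (Or.inr hx))
  · rcases Finset.mem_union.1 hx with hx | hx
    · exact (hx₁₂ x hx).1
    · rcases Finset.mem_insert.1 hx with rfl | hx
      · exact hg₁e.symm
      rcases Finset.mem_insert.1 hx with rfl | hx
      · exact hg₁f.symm
      · exact fun hh => hg₁K (hh ▸ hx)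
  · rcases Finset.mem_union.1 hx with hx | hx
    · exact (hx₁₂ x hx).2
    · rcases Finset.mem_insert.1 hx with rfl | hx
      · exact hg₂e.symm
      rcases Finset.mem_insert.1 hx with rfl | hx
      · exact hg₂f.symm
      · exact fun hh => hg₂K (hh ▸ hx)
  · -- the re-weighted instance `D₀ ∪ h`
    intro c hc hhK hhe
    refine ih (Function.update w s(u₁, u₂) c) (update_nonneg w hw _ hc)
      (insert s(u₁, u₂) (((D.erase s(v, u₁)).erase s(v, u₂)).erase s(u₁, u₂))) K e f ?_ ?_ ?_ ?_ heK ?_ hfK hef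
    · refine card_lt_of_subset_series (h := s(u₁, u₂)) hg₁E hg₂E hg₁₂ fun x hx => ?_
      rcases Finset.mem_union.1 hx with hx | hx
      · rcases Finset.mem_insert.1 hx with hx | hx
        · exact Or.inl hx
        · have hx' := Finset.mem_of_mem_erase hx
          exact Or.inr ⟨Finset.mem_union_left _ (sD hx'), hx₁₂ x hx'⟩
      · rcases Finset.mem_insert.1 hx with rfl | hx
        · exact Or.inr ⟨heE, hg₁e.symm, hg₂e.symm⟩
        rcases Finset.mem_insert.1 hx with rfl | hx
        · exact Or.inr ⟨hfE, hg₁f.symm, hg₂f.symm⟩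
        · exact Or.inr ⟨by simp [hx], fun hh => hg₁K (hh ▸ hx), fun hh => hg₂K (hh ▸ hx)⟩
    · intro x hx
      rcases Finset.mem_union.1 hx with hx | hx
      · rcases Finset.mem_insert.1 hx with rfl | hx
        · exact hhT
        · exact hsub (Finset.mem_union_left _ (sD (Finset.mem_of_mem_erase hx)))
      · exact hsub (Finset.mem_union_right _ hx)
    · exact Finset.disjoint_insert_left.2
        ⟨hhK, Finset.disjoint_of_subset_left (Finset.erase_subset _ _) dis₀⟩
    · rw [Finset.mem_insert, not_or]
      exact ⟨fun hh => hhe hh.symm, fun hh => heD (sD (Finset.mem_of_mem_erase hh))⟩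
    · rw [Finset.mem_insert, not_or]
      exact ⟨fun hh => hhf hh.symm, fun hh => hfD (sD (Finset.mem_of_mem_erase hh))⟩
  · -- the plain instance `D₀`
    intro _
    refine ih w hw ((D.erase s(v, u₁)).erase s(v, u₂)) K e f ?_ (sub₀.trans hsub) dis₀
      (fun hh => heD (sD hh)) heK (fun hh => hfD (sD hh)) hfK hef
    refine card_lt_of_subset_series (h := s(u₁, u₂)) hg₁E hg₂E hg₁₂ fun x hx => Or.inr ⟨sub₀ hx, ?_⟩
    rcases Finset.mem_union.1 hx with hx | hx
    · exact hx₁₂ x hx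
    · rcases Finset.mem_insert.1 hx with rfl | hx
      · exact ⟨hg₁e.symm, hg₂e.symm⟩
      rcases Finset.mem_insert.1 hx with rfl | hx
      · exact ⟨hg₁f.symm, hg₂f.symm⟩
      · exact ⟨fun hh => hg₁K (hh ▸ hx), fun hh => hg₂K (hh ▸ hx)⟩


end Summit.CriticalPhenomena.PercolationContinuityZ3.Theorems.ForestRayleigh
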